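import Literature.NumberTheory.Automorphic.UnitaryGroupHeisenbergPartTorusStage
import Literature.NumberTheory.Automorphic.UnitaryGroupHeisenbergPartInnerIntegral
import HarnessLib

/-!
# The Heisenberg part of the unipotent term: local boundedness of `ψʳ_T` and the `Ω_N × K_U` Fubini swap
# `∫_{n ∈ Ω_N} ∫_K ψʳ_T(n (t k)) dμ_K dμ_N = ∫_K ∫_{n ∈ Ω_N} ψʳ_T(n (t k)) dμ_N dμ_K`
(Rogawski (1990), proof of Prop. 7.3.2, p. 96–97: `dg = δ_B(m)⁻¹ dn dm dk`, the order of the `n`- and `k`-integrations)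

Topic `NumberTheory/Automorphic`; namespace `Literature.NumberTheory.Automorphic.UnitaryGroup`. THEOREMS ONLY over accepted tree
modules (no definition, no named fact, no instance, no notation, no `sorry`). Row (E-N) FILE 3 of the Heisenberg part (E) of the unipotent
term `P_{z·𝒰}` (LAW 5 road of `Cruxes/H413/Lines/F0_T1InnerFormTraceIdentity.lean`, crux H413; cell hodgecm-mathlib): between ★ (E-GN)
`exists_heisPart_integral_eq_torus` (inner order `∫_{Ω_N} ∫_K`) and ★ (E-N) FILE 2 `integrableOn_and_setIntegral_heisHaar_heisBracket_eq`
(pointwise in `y = t k`, consumed under `∫_K` by the (E-T) normal form).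

Letters as in ★ B1 ∕ (E0) ∕ (E-G): `ψʳ_T(g) := Σ'_{ξ ∈ E^×} Σ'_{w ∈ E⁻} f(g⁻¹ (z₁ u(ξ, w)) g) − 1_{T < H(g)} K_{B,𝔬}(g, g)` INLINE,
`u(ξ,w) := heisChart hc (algebraMap ξ, w)`, `Ω_N := heisHomeomorph hc '' (D_E ×ˢ 𝓕⁻)`, `μ_N := heisHaar hc μX μY`, `K_U` the compact subgroup of
★ (G-b) with its Haar measure `μK`.

* §1 LOCAL BOUNDS: `exists_forall_norm_tsum_tsum_heis_conj_le` — on a compact set of `g` the Heisenberg double sum is a finite sum over a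
  fixed finite set of `(ξ, w)` (★ (E-N) FILE 1 `finite_setOf_heis_exists_conj_mem_of_isCompact`), hence bounded by `#P · ‖f‖_∞`;
  `exists_forall_norm_kernelBorelTailClass_le` — the class tail is bounded on compacts (★ central formula `kernelBorelClass_eq_smul_integral_central`,
  the `m`-integrand vanishes off a compact subset of `N(𝔸_F)`).
* §2 `integrable_heisBracket_prod` — `(n, k) ↦ ψʳ_T(n (t k))` is integrable on `Ω_N × K_U` (bounded and measurable on a set of finite measure);
  **`setIntegral_heisHaar_integral_heisBracket_swap`** — the Fubini swap at every `t`.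
* §3 **`exists_heisPart_integral_eq_torus_kOuter`** — ★ (E-GN) restated with the `K`-integral OUTSIDE:
  `∫_G β ψʳ_T = C ∫_T (w_T(t) δ_B(t)⁻¹) • ∫_K ∫_{n ∈ Ω_N} ψʳ_T(n (t k)) dμ_N dμ_K dμ_T` for `T ≫ 0`.

## References
* J. D. Rogawski, *Automorphic Representations of Unitary Groups in Three Variables*, Ann. of Math. Stud. 123 (1990), §7.3 Prop. 7.3.2
  (pp. 95–97), §2.2 (p. 13) [Rogawski1990].
* J. Arthur, *The trace formula in invariant form*, Ann. of Math. 114 (1981), §2 [Arthur1981TraceFormulaInvariantForm].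
-/

set_option autoImplicit false

noncomputable section

open MeasureTheory MeasureTheory.Measure Set Filter Function NumberField IsDedekindDomain Polynomial Topology
  Literature.MeasureTheory.Group
open scoped ENNReal NNReal Topology MatrixGroups Pointwise

namespace Literature.NumberTheory.Automorphic

namespace UnitaryGroup

variable {F E : Type} [Field F] [NumberField F] [Field E] [NumberField E] [Algebra F E]
  {c : E ≃ₐ[F] E} {ι : Type*}

variable (ζ : ratOne F E c) {z₁ : (quasiSplit F E c 3).arithmeticSubgroup}

/-! ## §1 Local bounds -/

section Bounds

/-- **The Heisenberg double sum is bounded on compact sets**: for `f ∈ C_c(G(𝔸_F))` and a compact `C ⊆ G(𝔸_F)` there is `M` with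
`‖Σ'_{ξ ∈ E^×} Σ'_{w ∈ E⁻} f(g⁻¹ (z₁ u(ξ,w)) g)‖ ≤ M` for all `g ∈ C` — only the finitely many `(ξ, w)` with `g⁻¹ u(ξ,w) g ∈ z₁⁻¹ · supp f`
for some `g ∈ C` contribute (★ `finite_setOf_heis_exists_conj_mem_of_isCompact`). [cite: Rogawski1990, §2.2 (p. 13)] -/
theorem exists_forall_norm_tsum_tsum_heis_conj_le (hc : c * c = 1)
    (hz₁ : (z₁ : (quasiSplit F E c 3).Adelic) =
      (quasiSplit F E c 3).toAdelic (ratCenter F E c 3 ((StdForm.antidiagonal 3).over E) ζ))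
    {f : (quasiSplit F E c 3).Adelic → ℂ} (hfc : Continuous f) (hf : HasCompactSupport f)
    {C : Set (quasiSplit F E c 3).Adelic} (hC : IsCompact C) :
    ∃ M : ℝ, ∀ g ∈ C, ‖∑' ξ : {ξ : E // ξ ≠ 0}, ∑' w : rationalTraceZero F E c,
        f (g⁻¹ * ((z₁ : (quasiSplit F E c 3).Adelic) *
          (((heisChart hc (algebraMap E (AdeleRing (𝓞 E) E) (ξ : E), (w : traceZeroAdele F E c))) :
            adelicUnipotent F E c 3) : (quasiSplit F E c 3).Adelic)) * g)‖ ≤ M := by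
  classical
  obtain ⟨Mf, hMf⟩ := hfc.bounded_above_of_compact_support hf
  -- the compact target `z₁⁻¹ · tsupport f` and the finite set of contributing pairs
  set K : Set (quasiSplit F E c 3).Adelic := (fun v => (z₁ : (quasiSplit F E c 3).Adelic)⁻¹ * v) '' tsupport f with hKdef
  have hK : IsCompact K := hf.isCompact.image (continuous_const.mul continuous_id)
  have hfin := finite_setOf_heis_exists_conj_mem_of_isCompact (F := F) (E := E) (c := c) hc hC hK
  set P := hfin.toFinset with hPdef
  refine ⟨P.card * Mf, fun g hg => ?_⟩
  -- the family at `g` and its finite support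
  set Fg : {ξ : E // ξ ≠ 0} × rationalTraceZero F E c → ℂ := fun p =>
    f (g⁻¹ * ((z₁ : (quasiSplit F E c 3).Adelic) *
      (((heisChart hc (algebraMap E (AdeleRing (𝓞 E) E) (p.1 : E), (p.2 : traceZeroAdele F E c))) :
        adelicUnipotent F E c 3) : (quasiSplit F E c 3).Adelic)) * g) with hFgdef
  have hsupp : ∀ p, p ∉ P → Fg p = 0 := by
    intro p hp
    by_contra hne
    apply hp
    rw [hPdef, hfin.mem_toFinset]
    refine ⟨g, hg, ?_⟩
    -- `g⁻¹ u g = z₁⁻¹ (g⁻¹ (z₁ u) g)` lies in `z₁⁻¹ · tsupport f`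
    refine ⟨g⁻¹ * ((z₁ : (quasiSplit F E c 3).Adelic) *
      (((heisChart hc (algebraMap E (AdeleRing (𝓞 E) E) (p.1 : E), (p.2 : traceZeroAdele F E c))) :
        adelicUnipotent F E c 3) : (quasiSplit F E c 3).Adelic)) * g, subset_tsupport _ hne, ?_⟩
    have hz : (z₁ : (quasiSplit F E c 3).Adelic) * g⁻¹ = g⁻¹ * (z₁ : (quasiSplit F E c 3).Adelic) := by
      rw [hz₁]; exact toAdelic_ratCenter_mul_comm ζ g⁻¹
    calc (z₁ : (quasiSplit F E c 3).Adelic)⁻¹ * (g⁻¹ * ((z₁ : (quasiSplit F E c 3).Adelic) *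
          (((heisChart hc (algebraMap E (AdeleRing (𝓞 E) E) (p.1 : E), (p.2 : traceZeroAdele F E c))) :
            adelicUnipotent F E c 3) : (quasiSplit F E c 3).Adelic)) * g)
        = (z₁ : (quasiSplit F E c 3).Adelic)⁻¹ * ((g⁻¹ * (z₁ : (quasiSplit F E c 3).Adelic)) *
          (((heisChart hc (algebraMap E (AdeleRing (𝓞 E) E) (p.1 : E), (p.2 : traceZeroAdele F E c))) :
            adelicUnipotent F E c 3) : (quasiSplit F E c 3).Adelic)) * g := by simp only [mul_assoc]
      _ = (z₁ : (quasiSplit F E c 3).Adelic)⁻¹ * (((z₁ : (quasiSplit F E c 3).Adelic) * g⁻¹) *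
          (((heisChart hc (algebraMap E (AdeleRing (𝓞 E) E) (p.1 : E), (p.2 : traceZeroAdele F E c))) :
            adelicUnipotent F E c 3) : (quasiSplit F E c 3).Adelic)) * g := by rw [hz]
      _ = g⁻¹ * (((heisChart hc (algebraMap E (AdeleRing (𝓞 E) E) (p.1 : E), (p.2 : traceZeroAdele F E c))) :
            adelicUnipotent F E c 3) : (quasiSplit F E c 3).Adelic) * g := by
          simp only [mul_assoc, inv_mul_cancel_left]
  have hsum : Summable Fg := summable_of_ne_finset_zero (s := P) fun p hp => hsupp p hp
  -- `Σ'_ξ Σ'_w = Σ'_{(ξ,w)} = Σ_{P}`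
  have hprod : (∑' ξ : {ξ : E // ξ ≠ 0}, ∑' w : rationalTraceZero F E c,
      f (g⁻¹ * ((z₁ : (quasiSplit F E c 3).Adelic) *
        (((heisChart hc (algebraMap E (AdeleRing (𝓞 E) E) (ξ : E), (w : traceZeroAdele F E c))) :
          adelicUnipotent F E c 3) : (quasiSplit F E c 3).Adelic)) * g)) = ∑' p, Fg p := (hsum.tsum_prod).symm
  rw [hprod, tsum_eq_sum (s := P) fun p hp => hsupp p hp]
  calc ‖∑ p ∈ P, Fg p‖ ≤ ∑ p ∈ P, ‖Fg p‖ := norm_sum_le _ _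
    _ ≤ ∑ _p ∈ P, Mf := Finset.sum_le_sum fun p _ => hMf _
    _ = P.card * Mf := by rw [Finset.sum_const, nsmul_eq_mul]

variable [MeasurableSpace (adelicUnipotent F E c 3)] [BorelSpace (adelicUnipotent F E c 3)]

/-- **The class tail is bounded on compact sets** at the central class: `|1_{T<H(g)} K_{B,𝔬}(g,g)| ≤ ν(𝓕)⁻¹ ∫_N |f(g⁻¹ z₁ m g)| dν(m)
≤ ν(𝓕)⁻¹ ‖f‖_∞ ν(S)` where `S ⊆ N(𝔸_F)` is the compact set of `m` with `g⁻¹ z₁ m g ∈ supp f` for some `g ∈ C` (★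
`kernelBorelClass_eq_smul_integral_central`). [cite: Rogawski1990, §2.2 (p. 13)] -/
theorem exists_forall_norm_kernelBorelTailClass_le {cl : (quasiSplit F E c 3).arithmeticSubgroup → ι}
    (ν : Measure (adelicUnipotent F E c 3)) [ν.IsHaarMeasure]
    {𝓕 : Set (adelicUnipotent F E c 3)} (h𝓕 : IsFundamentalDomain (rationalUnipotent F E c 3) 𝓕 ν)
    (hclN : IsUnipotentInvariantOnBorel F E c 3 cl) {i : ι}
    (hcl : ∀ γ : (quasiSplit F E c 3).arithmeticSubgroup, cl γ = i ↔
      ((adelicVal F E c 3 _ (γ : (quasiSplit F E c 3).Adelic) : GL (Fin 3) (AdeleRing (𝓞 E) E)) :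
          Matrix (Fin 3) (Fin 3) (AdeleRing (𝓞 E) E)).charpoly =
        ((X - C ((ζ : Eˣ) : E)) ^ 3).map (algebraMap E (AdeleRing (𝓞 E) E)))
    {f : (quasiSplit F E c 3).Adelic → ℂ} (hfc : Continuous f) (hf : HasCompactSupport f) (T : ℝ≥0)
    {C : Set (quasiSplit F E c 3).Adelic} (hC : IsCompact C) :
    ∃ M : ℝ, ∀ g ∈ C, ‖kernelBorelTailClass ν 𝓕 T cl i f g‖ ≤ M := by
  haveI : T2Space (quasiSplit F E c 3).Adelic :=
    inferInstanceAs (T2Space (adelic F E c 3 ((StdForm.antidiagonal 3).over E)))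
  haveI : T2Space (AdeleRing (𝓞 E) E) := t2Space_adeleRing_of_numberField E
  obtain ⟨Mf, hMf⟩ := hfc.bounded_above_of_compact_support hf
  have hMf0 : 0 ≤ Mf := le_trans (norm_nonneg _) (hMf 1)
  set zA := (quasiSplit F E c 3).toAdelic (ratCenter F E c 3 ((StdForm.antidiagonal 3).over E) ζ) with hzA
  -- the compact set of `m` that can contribute, for `g ∈ C`
  have hNcl : IsClosed ((adelicUnipotent F E c 3 : Set (quasiSplit F E c 3).Adelic)) := by
    change IsClosed (⇑(adelicVal F E c 3 ((StdForm.antidiagonal 3).over E)) ⁻¹'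
      ((upperUnitriangular (Fin 3) (AdeleRing (𝓞 E) E) : Subgroup (GL (Fin 3) (AdeleRing (𝓞 E) E))) :
        Set (GL (Fin 3) (AdeleRing (𝓞 E) E))))
    exact (isClosed_upperUnitriangular (R := AdeleRing (𝓞 E) E)).preimage continuous_subtype_val
  set S₀ : Set (quasiSplit F E c 3).Adelic := (fun p : (quasiSplit F E c 3).Adelic × (quasiSplit F E c 3).Adelic =>
    zA⁻¹ * (p.1 * p.2 * p.1⁻¹)) '' (C ×ˢ tsupport f) with hS₀
  have hS₀c : IsCompact S₀ := (hC.prod hf.isCompact).image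
    (continuous_const.mul ((continuous_fst.mul continuous_snd).mul continuous_fst.inv))
  set S : Set (adelicUnipotent F E c 3) := Subtype.val ⁻¹' S₀ with hS
  have hSc : IsCompact S := hNcl.isClosedEmbedding_subtypeVal.isCompact_preimage hS₀c
  have hSν : ν S < ⊤ := hSc.measure_lt_top
  refine ⟨(ν 𝓕).toReal⁻¹ * (Mf * ν.real S), fun g hg => ?_⟩
  -- the tail is either `0` or the diagonal class kernel
  by_cases hT : T < borelHeight g
  swap
  · rw [kernelBorelTailClass_of_not_lt cl i f hT, norm_zero]
    exact mul_nonneg (inv_nonneg.2 ENNReal.toReal_nonneg) (mul_nonneg hMf0 ENNReal.toReal_nonneg)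
  rw [kernelBorelTailClass_of_lt cl i f hT, kernelBorelClass_eq_smul_integral_central ν h𝓕 hclN ζ hcl hfc hf g g,
    norm_smul, Real.norm_eq_abs, abs_of_nonneg (inv_nonneg.2 ENNReal.toReal_nonneg)]
  gcongr
  -- the integrand vanishes off `S` and is bounded by `Mf` on `S`
  have hvan : ∀ m : adelicUnipotent F E c 3, m ∉ S →
      f (g⁻¹ * zA * ((m : adelicUnipotent F E c 3) : (quasiSplit F E c 3).Adelic) * g) = 0 := by
    intro m hm
    by_contra hne
    apply hm
    change ((m : adelicUnipotent F E c 3) : (quasiSplit F E c 3).Adelic) ∈ S₀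
    refine ⟨(g, g⁻¹ * zA * ((m : adelicUnipotent F E c 3) : (quasiSplit F E c 3).Adelic) * g),
      ⟨hg, subset_tsupport _ hne⟩, ?_⟩
    simp only []
    group
  rw [← setIntegral_eq_integral_of_forall_compl_eq_zero (s := S) (fun m hm => hvan m hm)]
  exact norm_setIntegral_le_of_norm_le_const hSν fun m _ => hMf _

end Bounds

/-! ## §2 Integrability on `Ω_N × K_U` and the Fubini swap -/

section Swap

variable [MeasurableSpace (quasiSplit F E c 3).Adelic] [BorelSpace (quasiSplit F E c 3).Adelic]
  [MeasurableSpace (AdeleRing (𝓞 E) E)] [BorelSpace (AdeleRing (𝓞 E) E)] [LocallyCompactSpace (AdeleRing (𝓞 E) E)]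
  [MeasurableSpace (adelicUnipotent F E c 3)] [BorelSpace (adelicUnipotent F E c 3)]

/-- **`(n, k) ↦ ψʳ_T(n (t k))` is integrable on `Ω_N × K_U`**: `ψʳ_T` is Borel (★ `measurable_heisPart`) and bounded on the compact
`Ω̄_N · t · K_U` (§1), and `Ω_N × K_U` has finite measure. [cite: Rogawski1990, §7.3 (p. 96)] -/
theorem integrable_heisBracket_prod {cl : (quasiSplit F E c 3).arithmeticSubgroup → ι} (hc : c * c = 1)
    (hz₁ : (z₁ : (quasiSplit F E c 3).Adelic) =
      (quasiSplit F E c 3).toAdelic (ratCenter F E c 3 ((StdForm.antidiagonal 3).over E) ζ))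
    (ν : Measure (adelicUnipotent F E c 3)) [ν.IsHaarMeasure]
    {𝓕 : Set (adelicUnipotent F E c 3)} (h𝓕 : IsFundamentalDomain (rationalUnipotent F E c 3) 𝓕 ν)
    (hclN : IsUnipotentInvariantOnBorel F E c 3 cl) {i : ι}
    (hcl : ∀ γ : (quasiSplit F E c 3).arithmeticSubgroup, cl γ = i ↔
      ((adelicVal F E c 3 _ (γ : (quasiSplit F E c 3).Adelic) : GL (Fin 3) (AdeleRing (𝓞 E) E)) :
          Matrix (Fin 3) (Fin 3) (AdeleRing (𝓞 E) E)).charpoly =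
        ((X - C ((ζ : Eˣ) : E)) ^ 3).map (algebraMap E (AdeleRing (𝓞 E) E)))
    {f : (quasiSplit F E c 3).Adelic → ℂ} (hfc : Continuous f) (hf : HasCompactSupport f) (T : ℝ≥0)
    (μK : Measure ((standardMaximalCompactGL 3 E).comap
      (adelicVal F E c 3 ((StdForm.antidiagonal 3).over E)) : Subgroup (quasiSplit F E c 3).Adelic))
    [μK.IsHaarMeasure]
    (μX : Measure (AdeleRing (𝓞 E) E)) [μX.IsAddHaarMeasure]
    (μY : Measure (traceZeroAdele F E c)) [μY.IsAddHaarMeasure] (t : (quasiSplit F E c 3).Adelic) :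
    Integrable (fun p : unipotentInBorel F E c 3 × ((standardMaximalCompactGL 3 E).comap
        (adelicVal F E c 3 ((StdForm.antidiagonal 3).over E)) : Subgroup (quasiSplit F E c 3).Adelic) =>
      (∑' ξ : {ξ : E // ξ ≠ 0}, ∑' w : rationalTraceZero F E c,
        f ((((p.1 : borelAdelic F E c 3) : (quasiSplit F E c 3).Adelic) * (t * (p.2 : (quasiSplit F E c 3).Adelic)))⁻¹ *
          ((z₁ : (quasiSplit F E c 3).Adelic) *
            (((heisChart hc (algebraMap E (AdeleRing (𝓞 E) E) (ξ : E), (w : traceZeroAdele F E c))) :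
              adelicUnipotent F E c 3) : (quasiSplit F E c 3).Adelic)) *
          (((p.1 : borelAdelic F E c 3) : (quasiSplit F E c 3).Adelic) * (t * (p.2 : (quasiSplit F E c 3).Adelic))))) -
      kernelBorelTailClass ν 𝓕 T cl i f
        (((p.1 : borelAdelic F E c 3) : (quasiSplit F E c 3).Adelic) * (t * (p.2 : (quasiSplit F E c 3).Adelic))))
      (((heisHaar hc μX μY).restrict (heisHomeomorph hc '' (adeleFundamentalDomain E ×ˢ traceZeroFundamentalDomain F E c))).prod
        μK) := by
  haveI : T2Space (quasiSplit F E c 3).Adelic :=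
    inferInstanceAs (T2Space (adelic F E c 3 ((StdForm.antidiagonal 3).over E)))
  haveI : SecondCountableTopology (quasiSplit F E c 3).Adelic :=
    inferInstanceAs (SecondCountableTopology (adelic F E c 3 ((StdForm.antidiagonal 3).over E)))
  haveI : LocallyCompactSpace (quasiSplit F E c 3).Adelic :=
    inferInstanceAs (LocallyCompactSpace (adelic F E c 3 ((StdForm.antidiagonal 3).over E)))
  haveI : T2Space (AdeleRing (𝓞 E) E) := t2Space_adeleRing_of_numberField E
  haveI := secondCountableTopology_adeleRing E
  haveI : BorelSpace (borelAdelic F E c 3) := Subtype.borelSpace _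
  haveI : BorelSpace (unipotentInBorel F E c 3) := Subtype.borelSpace _
  haveI : SecondCountableTopology (borelAdelic F E c 3) := secondCountableTopology_borelAdelic
  haveI : SecondCountableTopology (unipotentInBorel F E c 3) := TopologicalSpace.Subtype.secondCountableTopology _
  have hKc : IsCompact (((standardMaximalCompactGL 3 E).comap (adelicVal F E c 3 ((StdForm.antidiagonal 3).over E)) :
      Subgroup (quasiSplit F E c 3).Adelic) : Set (quasiSplit F E c 3).Adelic) :=
    isCompact_comap_adelicVal_standardMaximalCompactGL
  haveI : CompactSpace ((standardMaximalCompactGL 3 E).comap (adelicVal F E c 3 ((StdForm.antidiagonal 3).over E)) :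
      Subgroup (quasiSplit F E c 3).Adelic) := isCompact_iff_compactSpace.1 hKc
  haveI : SecondCountableTopology ((standardMaximalCompactGL 3 E).comap
      (adelicVal F E c 3 ((StdForm.antidiagonal 3).over E)) : Subgroup (quasiSplit F E c 3).Adelic) :=
    TopologicalSpace.Subtype.secondCountableTopology _
  haveI : BorelSpace ((standardMaximalCompactGL 3 E).comap
      (adelicVal F E c 3 ((StdForm.antidiagonal 3).over E)) : Subgroup (quasiSplit F E c 3).Adelic) := Subtype.borelSpace _
  haveI : IsFiniteMeasure μK := CompactSpace.isFiniteMeasure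
  -- `N(𝔸_F)` closed: `ν` s-finite (for measurability of the tail)
  have hNcl : IsClosed ((adelicUnipotent F E c 3 : Set (quasiSplit F E c 3).Adelic)) := by
    change IsClosed (⇑(adelicVal F E c 3 ((StdForm.antidiagonal 3).over E)) ⁻¹'
      ((upperUnitriangular (Fin 3) (AdeleRing (𝓞 E) E) : Subgroup (GL (Fin 3) (AdeleRing (𝓞 E) E))) :
        Set (GL (Fin 3) (AdeleRing (𝓞 E) E))))
    exact (isClosed_upperUnitriangular (R := AdeleRing (𝓞 E) E)).preimage continuous_subtype_val
  haveI : SecondCountableTopology (adelicUnipotent F E c 3) := TopologicalSpace.Subtype.secondCountableTopology _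
  haveI : LocallyCompactSpace (adelicUnipotent F E c 3) := hNcl.locallyCompactSpace
  haveI : SFinite ν := inferInstance
  -- the restricted box measure is finite
  set Ω : Set (unipotentInBorel F E c 3) :=
    heisHomeomorph hc '' (adeleFundamentalDomain E ×ˢ traceZeroFundamentalDomain F E c) with hΩdef
  have hΩm : MeasurableSet Ω := measurableSet_image_heisHomeomorph_fundamentalDomain hc
  have hΩfin : heisHaar hc μX μY Ω < ⊤ := heisHaar_image_fundamentalDomain_lt_top hc μX μY
  haveI : IsFiniteMeasure ((heisHaar hc μX μY).restrict Ω) := isFiniteMeasure_restrict.2 hΩfin.ne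
  haveI := locallyCompactSpace_traceZeroAdele (F := F) (E := E) (c := c)
  haveI : SecondCountableTopology (traceZeroAdele F E c) := TopologicalSpace.Subtype.secondCountableTopology _
  haveI : SFinite (heisHaar hc μX μY) := by
    rw [show heisHaar hc μX μY = (μX.prod μY).map (heisHomeomorph hc) from rfl]; infer_instance
  -- the bracket `ψʳ_T` and its measurability
  set ψ : (quasiSplit F E c 3).Adelic → ℂ := fun g =>
    (∑' ξ : {ξ : E // ξ ≠ 0}, ∑' w : rationalTraceZero F E c,
      f (g⁻¹ * ((z₁ : (quasiSplit F E c 3).Adelic) *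
        (((heisChart hc (algebraMap E (AdeleRing (𝓞 E) E) (ξ : E), (w : traceZeroAdele F E c))) :
          adelicUnipotent F E c 3) : (quasiSplit F E c 3).Adelic)) * g)) -
      kernelBorelTailClass ν 𝓕 T cl i f g with hψdef
  have hψm : Measurable ψ := measurable_heisPart (z₁ := z₁) (cl := cl) hc ν 𝓕 T i hfc
  -- the point map `(n, k) ↦ n (t k)` is continuous
  have hpt : Continuous fun p : unipotentInBorel F E c 3 × ((standardMaximalCompactGL 3 E).comap
      (adelicVal F E c 3 ((StdForm.antidiagonal 3).over E)) : Subgroup (quasiSplit F E c 3).Adelic) =>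
      ((p.1 : borelAdelic F E c 3) : (quasiSplit F E c 3).Adelic) * (t * (p.2 : (quasiSplit F E c 3).Adelic)) :=
    ((continuous_subtype_val.comp continuous_subtype_val).comp continuous_fst).mul
      (continuous_const.mul (continuous_subtype_val.comp continuous_snd))
  -- a compact superset of `Ω_N`, and the compact set of points `n (t k)`
  obtain ⟨Km, hKm, hsubKm⟩ := exists_isCompact_traceZeroFundamentalDomain_subset (F := F) (E := E) (c := c) hc
  set CN : Set (unipotentInBorel F E c 3) := heisHomeomorph hc '' (closure (adeleFundamentalDomain E) ×ˢ Km) with hCNdef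
  have hCN : IsCompact CN := ((isCompact_closure_adeleFundamentalDomain (K := E)).prod hKm).image (heisHomeomorph hc).continuous
  have hΩCN : Ω ⊆ CN := Set.image_mono (Set.prod_mono subset_closure hsubKm)
  set Cg : Set (quasiSplit F E c 3).Adelic := (fun p : unipotentInBorel F E c 3 × ((standardMaximalCompactGL 3 E).comap
      (adelicVal F E c 3 ((StdForm.antidiagonal 3).over E)) : Subgroup (quasiSplit F E c 3).Adelic) =>
      ((p.1 : borelAdelic F E c 3) : (quasiSplit F E c 3).Adelic) * (t * (p.2 : (quasiSplit F E c 3).Adelic))) ''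
        (CN ×ˢ Set.univ) with hCgdef
  have hCg : IsCompact Cg := (hCN.prod isCompact_univ).image hpt
  -- local bounds on `Cg`
  obtain ⟨M₁, hM₁⟩ := exists_forall_norm_tsum_tsum_heis_conj_le ζ hc hz₁ hfc hf hCg
  obtain ⟨M₂, hM₂⟩ := exists_forall_norm_kernelBorelTailClass_le ζ ν h𝓕 hclN hcl hfc hf T hCg
  -- integrability: measurable and bounded on a finite-measure set
  refine ⟨((hψm.comp hpt.measurable).stronglyMeasurable).aestronglyMeasurable, ?_⟩
  refine HasFiniteIntegral.of_bounded (C := M₁ + M₂) ?_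
  have hmeas_eq : ((heisHaar hc μX μY).restrict Ω).prod μK = ((heisHaar hc μX μY).prod μK).restrict (Ω ×ˢ Set.univ) := by
    rw [← Measure.prod_restrict, Measure.restrict_univ]
  rw [hmeas_eq, ae_restrict_iff' (hΩm.prod MeasurableSet.univ)]
  refine ae_of_all _ fun p hp => ?_
  have hg : ((p.1 : borelAdelic F E c 3) : (quasiSplit F E c 3).Adelic) * (t * (p.2 : (quasiSplit F E c 3).Adelic)) ∈ Cg :=
    ⟨p, ⟨hΩCN hp.1, Set.mem_univ _⟩, rfl⟩
  exact (norm_sub_le _ _).trans (add_le_add (hM₁ _ hg) (hM₂ _ hg))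

/-- **THE `Ω_N × K_U` FUBINI SWAP** for the Heisenberg bracket at every `t ∈ G(𝔸_F)`:
`∫_{n ∈ Ω_N} ∫_K ψʳ_T(n (t k)) dμ_K ∂heisHaar = ∫_K ∫_{n ∈ Ω_N} ψʳ_T(n (t k)) ∂heisHaar dμ_K` (Mathlib `integral_integral_swap` on the
integrable product function of `integrable_heisBracket_prod`). [cite: Rogawski1990, §7.3 (p. 96)] -/
theorem setIntegral_heisHaar_integral_heisBracket_swap {cl : (quasiSplit F E c 3).arithmeticSubgroup → ι} (hc : c * c = 1)
    (hz₁ : (z₁ : (quasiSplit F E c 3).Adelic) =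
      (quasiSplit F E c 3).toAdelic (ratCenter F E c 3 ((StdForm.antidiagonal 3).over E) ζ))
    (ν : Measure (adelicUnipotent F E c 3)) [ν.IsHaarMeasure]
    {𝓕 : Set (adelicUnipotent F E c 3)} (h𝓕 : IsFundamentalDomain (rationalUnipotent F E c 3) 𝓕 ν)
    (hclN : IsUnipotentInvariantOnBorel F E c 3 cl) {i : ι}
    (hcl : ∀ γ : (quasiSplit F E c 3).arithmeticSubgroup, cl γ = i ↔
      ((adelicVal F E c 3 _ (γ : (quasiSplit F E c 3).Adelic) : GL (Fin 3) (AdeleRing (𝓞 E) E)) :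
          Matrix (Fin 3) (Fin 3) (AdeleRing (𝓞 E) E)).charpoly =
        ((X - C ((ζ : Eˣ) : E)) ^ 3).map (algebraMap E (AdeleRing (𝓞 E) E)))
    {f : (quasiSplit F E c 3).Adelic → ℂ} (hfc : Continuous f) (hf : HasCompactSupport f) (T : ℝ≥0)
    (μK : Measure ((standardMaximalCompactGL 3 E).comap
      (adelicVal F E c 3 ((StdForm.antidiagonal 3).over E)) : Subgroup (quasiSplit F E c 3).Adelic))
    [μK.IsHaarMeasure]
    (μX : Measure (AdeleRing (𝓞 E) E)) [μX.IsAddHaarMeasure]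
    (μY : Measure (traceZeroAdele F E c)) [μY.IsAddHaarMeasure] (t : (quasiSplit F E c 3).Adelic) :
    ∫ n in heisHomeomorph hc '' (adeleFundamentalDomain E ×ˢ traceZeroFundamentalDomain F E c),
        ∫ k, ((∑' ξ : {ξ : E // ξ ≠ 0}, ∑' w : rationalTraceZero F E c,
          f ((((n : borelAdelic F E c 3) : (quasiSplit F E c 3).Adelic) * (t * (k : (quasiSplit F E c 3).Adelic)))⁻¹ *
            ((z₁ : (quasiSplit F E c 3).Adelic) *
              (((heisChart hc (algebraMap E (AdeleRing (𝓞 E) E) (ξ : E), (w : traceZeroAdele F E c))) :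
                adelicUnipotent F E c 3) : (quasiSplit F E c 3).Adelic)) *
            (((n : borelAdelic F E c 3) : (quasiSplit F E c 3).Adelic) * (t * (k : (quasiSplit F E c 3).Adelic))))) -
          kernelBorelTailClass ν 𝓕 T cl i f
            (((n : borelAdelic F E c 3) : (quasiSplit F E c 3).Adelic) * (t * (k : (quasiSplit F E c 3).Adelic)))) ∂μK
        ∂(heisHaar hc μX μY) =
      ∫ k, ∫ n in heisHomeomorph hc '' (adeleFundamentalDomain E ×ˢ traceZeroFundamentalDomain F E c),
        ((∑' ξ : {ξ : E // ξ ≠ 0}, ∑' w : rationalTraceZero F E c,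
          f ((((n : borelAdelic F E c 3) : (quasiSplit F E c 3).Adelic) * (t * (k : (quasiSplit F E c 3).Adelic)))⁻¹ *
            ((z₁ : (quasiSplit F E c 3).Adelic) *
              (((heisChart hc (algebraMap E (AdeleRing (𝓞 E) E) (ξ : E), (w : traceZeroAdele F E c))) :
                adelicUnipotent F E c 3) : (quasiSplit F E c 3).Adelic)) *
            (((n : borelAdelic F E c 3) : (quasiSplit F E c 3).Adelic) * (t * (k : (quasiSplit F E c 3).Adelic))))) -
          kernelBorelTailClass ν 𝓕 T cl i f
            (((n : borelAdelic F E c 3) : (quasiSplit F E c 3).Adelic) * (t * (k : (quasiSplit F E c 3).Adelic))))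
        ∂(heisHaar hc μX μY) ∂μK := by
  haveI := secondCountableTopology_adeleRing E
  haveI := locallyCompactSpace_traceZeroAdele (F := F) (E := E) (c := c)
  haveI : SecondCountableTopology (traceZeroAdele F E c) := TopologicalSpace.Subtype.secondCountableTopology _
  haveI : SFinite (heisHaar hc μX μY) := by
    rw [show heisHaar hc μX μY = (μX.prod μY).map (heisHomeomorph hc) from rfl]; infer_instance
  have hKc : IsCompact (((standardMaximalCompactGL 3 E).comap (adelicVal F E c 3 ((StdForm.antidiagonal 3).over E)) :
      Subgroup (quasiSplit F E c 3).Adelic) : Set (quasiSplit F E c 3).Adelic) :=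
    isCompact_comap_adelicVal_standardMaximalCompactGL
  haveI : CompactSpace ((standardMaximalCompactGL 3 E).comap (adelicVal F E c 3 ((StdForm.antidiagonal 3).over E)) :
      Subgroup (quasiSplit F E c 3).Adelic) := isCompact_iff_compactSpace.1 hKc
  haveI : IsFiniteMeasure μK := CompactSpace.isFiniteMeasure
  exact integral_integral_swap (integrable_heisBracket_prod ζ hc hz₁ ν h𝓕 hclN hcl hfc hf T μK μX μY t)

end Swap

/-! ## §3 The (E-GN) head with the `K`-integral outside -/

section Head

variable [MeasurableSpace (quasiSplit F E c 3).Adelic] [BorelSpace (quasiSplit F E c 3).Adelic]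
  [MeasurableSpace (AdeleRing (𝓞 E) E)] [BorelSpace (AdeleRing (𝓞 E) E)] [LocallyCompactSpace (AdeleRing (𝓞 E) E)]
  [MeasurableSpace (adelicUnipotent F E c 3)] [BorelSpace (adelicUnipotent F E c 3)]

/-- **THE (E-GN) STAGE WITH THE `K`-INTEGRAL OUTSIDE** (★ `exists_heisPart_integral_eq_torus` ∘ §2): for `T ≫ 0`,
`∫_G β ψʳ_T dν_G = C ∫_T (w_T(t) δ_B(t)⁻¹) • ∫_K (∫_{n ∈ Ω_N} ψʳ_T(n (t k)) ∂heisHaar) dμ_K dμ_T` — the inner `n`-integral is the one evaluated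
pointwise in `y = t k` by ★ (E-N) FILE 2 `integrableOn_and_setIntegral_heisHaar_heisBracket_eq`. [cite: Rogawski1990, §7.3 Prop. 7.3.2 (pp. 96–97)]
[cite: Arthur1981TraceFormulaInvariantForm, §2] -/
theorem exists_heisPart_integral_eq_torus_kOuter {cl : (quasiSplit F E c 3).arithmeticSubgroup → ι} (hc : c * c = 1) (hc1 : c ≠ 1)
    (hz₁ : (z₁ : (quasiSplit F E c 3).Adelic) =
      (quasiSplit F E c 3).toAdelic (ratCenter F E c 3 ((StdForm.antidiagonal 3).over E) ζ))
    (hclN : IsUnipotentInvariantOnBorel F E c 3 cl)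
    (ν : Measure (adelicUnipotent F E c 3)) [ν.IsHaarMeasure]
    {𝓕 : Set (adelicUnipotent F E c 3)} (h𝓕 : IsFundamentalDomain (rationalUnipotent F E c 3) 𝓕 ν) {i : ι}
    (hcl : ∀ γ : (quasiSplit F E c 3).arithmeticSubgroup, cl γ = i ↔
      ((adelicVal F E c 3 _ (γ : (quasiSplit F E c 3).Adelic) : GL (Fin 3) (AdeleRing (𝓞 E) E)) :
          Matrix (Fin 3) (Fin 3) (AdeleRing (𝓞 E) E)).charpoly =
        ((X - C ((ζ : Eˣ) : E)) ^ 3).map (algebraMap E (AdeleRing (𝓞 E) E)))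
    {f : (quasiSplit F E c 3).Adelic → ℂ} (hfc : Continuous f) (hf : HasCompactSupport f)
    (νG : Measure (quasiSplit F E c 3).Adelic) [νG.IsHaarMeasure]
    (μB : Measure (borelAdelic F E c 3)) [μB.IsHaarMeasure]
    (μK : Measure ((standardMaximalCompactGL 3 E).comap
      (adelicVal F E c 3 ((StdForm.antidiagonal 3).over E)) : Subgroup (quasiSplit F E c 3).Adelic))
    [μK.IsHaarMeasure]
    (hBK : ∀ g : (quasiSplit F E c 3).Adelic, ∃ b ∈ borelAdelic F E c 3, ∃ k : (quasiSplit F E c 3).Adelic,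
      adelicVal F E c 3 ((StdForm.antidiagonal 3).over E) k ∈ standardMaximalCompactGL 3 E ∧ g = b * k)
    (μT : Measure (torusInBorel F E c 3)) [μT.IsHaarMeasure]
    (μX : Measure (AdeleRing (𝓞 E) E)) [μX.IsAddHaarMeasure]
    (μY : Measure (traceZeroAdele F E c)) [μY.IsAddHaarMeasure]
    {wT : torusInBorel F E c 3 → ℝ≥0∞}
    (hwT : IsCoveringWeight ((((quasiSplit F E c 3).arithmeticSubgroup).subgroupOf (borelAdelic F E c 3)).subgroupOf
      (torusInBorel F E c 3)) wT)
    {β : (quasiSplit F E c 3).Adelic → ℝ≥0∞}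
    (hβ : IsCoveringWeight ((arithmeticBorel F E c 3).map (quasiSplit F E c 3).arithmeticSubgroup.subtype) β)
    (hCinv : ∀ b ∈ arithmeticBorel F E c 3, ∀ y : (quasiSplit F E c 3).Adelic,
      (∑' w : {w : rationalTraceZero F E c // w ≠ 0},
        f (((b : (quasiSplit F E c 3).Adelic) * y)⁻¹ * ((z₁ : (quasiSplit F E c 3).Adelic) *
          (((heisChart hc ((0 : AdeleRing (𝓞 E) E), ((w.1 : rationalTraceZero F E c) : traceZeroAdele F E c))) :
            adelicUnipotent F E c 3) : (quasiSplit F E c 3).Adelic)) * ((b : (quasiSplit F E c 3).Adelic) * y))) =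
      ∑' w : {w : rationalTraceZero F E c // w ≠ 0},
        f (y⁻¹ * ((z₁ : (quasiSplit F E c 3).Adelic) *
          (((heisChart hc ((0 : AdeleRing (𝓞 E) E), ((w.1 : rationalTraceZero F E c) : traceZeroAdele F E c))) :
            adelicUnipotent F E c 3) : (quasiSplit F E c 3).Adelic)) * y))
    (hCfin : ∫⁻ g, β g * ‖∑' w : {w : rationalTraceZero F E c // w ≠ 0},
        f (g⁻¹ * ((z₁ : (quasiSplit F E c 3).Adelic) *
          (((heisChart hc ((0 : AdeleRing (𝓞 E) E), ((w.1 : rationalTraceZero F E c) : traceZeroAdele F E c))) :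
            adelicUnipotent F E c 3) : (quasiSplit F E c 3).Adelic)) * g)‖ₑ ∂νG < ∞)
    (hHint : ∃ T₀ : ℝ≥0, ∀ T : ℝ≥0, T₀ < T →
      ∫⁻ g, β g * ‖(∑' u : {u : rationalUnipotent F E c 3 // u ≠ 1},
        f (g⁻¹ * ((z₁ * ⟨(((u.1 : rationalUnipotent F E c 3) : adelicUnipotent F E c 3) :
          (quasiSplit F E c 3).Adelic), (u.1 : rationalUnipotent F E c 3).2⟩ :
            (quasiSplit F E c 3).arithmeticSubgroup) : (quasiSplit F E c 3).Adelic) * g)) -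
      kernelBorelTailClass ν 𝓕 T cl i f g‖ₑ ∂νG < ∞) :
    ∃ C : ℝ, 0 < C ∧ ∃ T₁ : ℝ≥0, ∀ T : ℝ≥0, T₁ < T →
      Integrable (fun g : (quasiSplit F E c 3).Adelic => (β g).toReal •
        ((∑' ξ : {ξ : E // ξ ≠ 0}, ∑' w : rationalTraceZero F E c,
          f (g⁻¹ * ((z₁ : (quasiSplit F E c 3).Adelic) *
            (((heisChart hc (algebraMap E (AdeleRing (𝓞 E) E) (ξ : E), (w : traceZeroAdele F E c))) :
              adelicUnipotent F E c 3) : (quasiSplit F E c 3).Adelic)) * g)) -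
          kernelBorelTailClass ν 𝓕 T cl i f g)) νG ∧
      ∫ g, (β g).toReal •
        ((∑' ξ : {ξ : E // ξ ≠ 0}, ∑' w : rationalTraceZero F E c,
          f (g⁻¹ * ((z₁ : (quasiSplit F E c 3).Adelic) *
            (((heisChart hc (algebraMap E (AdeleRing (𝓞 E) E) (ξ : E), (w : traceZeroAdele F E c))) :
              adelicUnipotent F E c 3) : (quasiSplit F E c 3).Adelic)) * g)) -
          kernelBorelTailClass ν 𝓕 T cl i f g) ∂νG =
        (C : ℂ) * ∫ t : torusInBorel F E c 3,
          ((wT t).toReal * ((torusRootModulus E 3 (diagUnit (t : borelAdelic F E c 3).2) : ℝ≥0) : ℝ)⁻¹) •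
            ∫ k, ∫ n in heisHomeomorph hc '' (adeleFundamentalDomain E ×ˢ traceZeroFundamentalDomain F E c),
              ((∑' ξ : {ξ : E // ξ ≠ 0}, ∑' w : rationalTraceZero F E c,
                f ((((n : borelAdelic F E c 3) : (quasiSplit F E c 3).Adelic) *
                    (((t : borelAdelic F E c 3) : (quasiSplit F E c 3).Adelic) * (k : (quasiSplit F E c 3).Adelic)))⁻¹ *
                  ((z₁ : (quasiSplit F E c 3).Adelic) *
                    (((heisChart hc (algebraMap E (AdeleRing (𝓞 E) E) (ξ : E), (w : traceZeroAdele F E c))) :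
                      adelicUnipotent F E c 3) : (quasiSplit F E c 3).Adelic)) *
                  (((n : borelAdelic F E c 3) : (quasiSplit F E c 3).Adelic) *
                    (((t : borelAdelic F E c 3) : (quasiSplit F E c 3).Adelic) * (k : (quasiSplit F E c 3).Adelic))))) -
                kernelBorelTailClass ν 𝓕 T cl i f (((n : borelAdelic F E c 3) : (quasiSplit F E c 3).Adelic) *
                  (((t : borelAdelic F E c 3) : (quasiSplit F E c 3).Adelic) * (k : (quasiSplit F E c 3).Adelic))))
              ∂(heisHaar hc μX μY) ∂μK ∂μT := by
  obtain ⟨C', hC', T₁, hT₁⟩ := exists_heisPart_integral_eq_torus ζ hc hc1 hz₁ hclN ν h𝓕 i hfc hf νG μB μK hBK μT μX μY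
    hwT hβ hCinv hCfin hHint
  refine ⟨C', hC', T₁, fun T hT => ?_⟩
  obtain ⟨hint, hval⟩ := hT₁ T hT
  refine ⟨hint, ?_⟩
  rw [hval]
  congr 1
  refine integral_congr_ae (ae_of_all _ fun t => ?_)
  dsimp only
  rw [setIntegral_heisHaar_integral_heisBracket_swap ζ hc hz₁ ν h𝓕 hclN hcl hfc hf T μK μX μY
    ((t : borelAdelic F E c 3) : (quasiSplit F E c 3).Adelic)]

end Head

end UnitaryGroup

end Literature.NumberTheory.Automorphic

end
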